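import Literature.AlgebraicGeometry.Hironaka2017.Proofs.S09LLUED.Lem95CoupledCountermodel
import HarnessLib

/-!
# Kill test K2.5 (register #44; slot W2.5 = L-47B-s3 «FINITE AB-RAY SUFFICES») on the carrier SW —
# numbers for res-adj-2 (unit res-L1-k25 = res-D-pv-021; PREREG L/k25/PREREG-K25.md sha16 014aa455e686b865)

[OURS · L W2.5 · K2.5] HIRONAKA CAMPAIGN D-0089, rescue ladder L, group G2 (§9 `H♭`), GAP row R47 (B) (Lemma 9.5
p.50 l.11–14, COUPLED depth choice; countermodel carriers SW p489606 / SB p491132 of res-type-055). This file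
is the kernel ARTEFACT of the pre-registered kill test; it words no verdict (res-adj-2 does) and asserts nothing of
the manuscript [Hironaka2017] (lit key `paper:url-3343fd9e678b`), which stays «under review» (D-0012/D-0089).
AI-written; weaker than expert review.

## Question and MODEL (PREREG-K25.md §A verbatim = res-adj-2 05:14:21Z; §B = the unit's operationalisation)
At depth `ℓ ∈ {3, 4}`: is there `ε′` with (i) the same `(α, β)`, (ii) a FINITE top block all of whose `u_j` are
`ρ^ℓ`-units with all derivative orders `|α+pβ|`, `|qγ_j| < p^ℓ`, (iii) `ε_SW − ε′ ∈ M_<` (the `ρ^ℓ(O)`-submodule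
generated by the monomials strictly BELOW the AB-ray)? MODEL: B1 carrier = `Lem95CoupledCountermodel` (p489606),
`E := Lem95Coupled.toFin 𝔽 2 εW ∈ 𝔽₂⟦x₀, x₁, x₂⟧` (`x₀ = y`), `p = 2`, `e = 1`, `(α, β) = (e₂, 0)`, `ε_SW := E`;
B2 ORDER = R054 `TopFrontier.pairKey` on the digit pair of a monomial (`digitA`, `digitB`, `monoKey`, `IsBelowRay`;
on SW: below ⟺ all exponents even, `isBelowRay_SW_iff`); B3 `M_<` = `MemBelow` (every monomial below the AB-ray;
the CLOSED span — most generous); B4 (i) ∧ (ii) = `AdmissibleTop` over row 052a's `StandardExpression 2 X 1 ℓ ε′`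
(units / digit bounds built in; `topBlock` a `Finset`), the question = `ExistsAdmissibleFiniteRay ℓ`.

## RESULT (numbers; §3–§4)
For EVERY `ℓ ≥ 2`, EVERY `ε′` with `E − ε′ ∈ M_<` and EVERY standard expression `X′` of `ε′` of depth `ℓ`:
`alpha X′ = e₂`, `beta X′ = 0` (so (i) is automatic), and the top block of `X′` contains the term
`t_ℓ = (e₂, 0, (0, 2^{ℓ−1} − 1, 1))` — the only term that can carry the ray monomial `ω₁^{2^ℓ−2} ω₂³` of `ε′`
(coefficient `1`: the monomial is NOT below the AB-ray, so `M_<` cannot touch it) — whose derivative order is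
`|qγ| = 2·(2^{ℓ−1} − 1 + 1) = 2^ℓ = p^ℓ`, NOT `< p^ℓ` (`exists_topBlock_degree_ge`). Hence
`¬ ExistsAdmissibleFiniteRay ℓ` for every `ℓ ≥ 2` (`not_existsAdmissibleFiniteRay`); instances T1 `ℓ = 3`
(`|qγ| = 8` vs `p^ℓ = 8`) and T2 `ℓ = 4` (`16` vs `16`): `T1_depth_three`, `T2_depth_four`. T3 (K-generic witness,
`ℓ = 3`) not run — moot under the pre-declared rule once T1 = NO.

## SIDE REMARK (PREREG §B9; NOT scored)
See the companion file `MarkedTransferCampaignW25FiniteRaySWPresentation.lean`: `(1 + ω₁²)·εW = ω₂³` and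
`(1 + ω₁)²·(y² + εW) = (y(1 + ω₁))² + ω₂³` in characteristic 2.

References: H. Hironaka, ms. 2017-03-23, Eq. (76)/(77) p.49, Lem. 9.5 p.50 l.11–15, Def. 9.12 / Eq. (78)–(80)
p.51–52 (UNDER ADJUDICATION, not cited as fact). [Hironaka2017] -/

-- `Summit.<Summit>.<Sub>.Theorems` with `Sub = Summit` (single-conjunct summit, D-0017)
set_option linter.dupNamespace false

noncomputable section

namespace Summit.ResolutionOfSingularities.ResolutionOfSingularities.Theorems.CampaignW25.SW

open MvPowerSeries
open Literature.AlgebraicGeometry.Hironaka2017.S09LLUED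
open Literature.AlgebraicGeometry.Hironaka2017.S09LLUED.TopFrontier
open Literature.AlgebraicGeometry.Hironaka2017.S09LLUED.Lem95Coupled
open Literature.AlgebraicGeometry.Hironaka2017.S09LLUED.Lem95CoupledCountermodel
open Literature.AlgebraicGeometry.Hironaka2017.S08UnitMonomial (StandardExpression)
open Literature.AlgebraicGeometry.Hironaka2017.S07Permissible.Cor720Countermodel (𝔽)

/-! ## §1 The MODEL: digits of a monomial, «strictly below the AB-ray», `M_<`, conditions (i)–(ii) -/

section Model

variable {K : Type} [CommRing K] {n : ℕ}

/-- [OURS · L W2.5 · K2.5 · MODEL B2] The `a`-digit vector of an exponent `m`: `a_i = m_i mod p` (row 052a `a_lt`: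
`a_i < p`) (OURS bookkeeping; cf. Hironaka2017 Eq. (76) (1) p.49 l.22). [folklore] -/
def digitA (p : ℕ) (m : Fin n →₀ ℕ) : Fin n →₀ ℕ :=
  Finsupp.mapRange (fun k => k % p) (Nat.zero_mod p) m

/-- [OURS · L W2.5 · K2.5 · MODEL B2] The `b`-digit vector of an exponent `m`: `b_i = (m_i div p) mod p^{e−1}`
(row 052a `b_lt`: `b_i < p^{e−1}`) (OURS bookkeeping; cf. Hironaka2017 Eq. (76) (1) p.49 l.22). [folklore] -/
def digitB (p e : ℕ) (m : Fin n →₀ ℕ) : Fin n →₀ ℕ :=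
  Finsupp.mapRange (fun k => (k / p) % p ^ (e - 1)) (by simp) m

/-- [OURS · L W2.5 · K2.5 · MODEL B2] The ORDER OF RECORD on monomials: R054's `TopFrontier.pairKey` of the digit pair
`(a(m), b(m))` (Mathlib `Finsupp.Lex` inside `Prod.Lex`, index `0` most significant) (OURS bookkeeping;
cf. Hironaka2017 Eq. (76) p.49 l.5–20). [folklore] -/
def monoKey (p e : ℕ) (m : Fin n →₀ ℕ) : Lex (Lex (Fin n →₀ ℕ) × Lex (Fin n →₀ ℕ)) :=
  toLex (toLex (digitA p m), toLex (digitB p e m))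

/-- [OURS · L W2.5 · K2.5 · MODEL B2] The monomial `x^m` lies STRICTLY BELOW the AB-ray of top pair `(α, β)`:
`pairKey (a(m), b(m)) < pairKey (α, β)` — the blocks `Σ_{b <lex β}` and `Σ_{a <lex α}` of Eq. (76) (OURS bookkeeping
definition; cf. Hironaka2017 Eq. (76) p.49 l.5–20 — not a statement of the manuscript). [folklore] -/
def IsBelowRay (p e : ℕ) (α β : Fin n →₀ ℕ) (m : Fin n →₀ ℕ) : Prop :=
  monoKey p e m < toLex (toLex α, toLex β)

/-- [OURS · L W2.5 · K2.5 · MODEL B3] `W ∈ M_<`: every monomial of `W` with non-zero coefficient is strictly below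
the AB-ray (the closed `ρ^ℓ(O)`-submodule generated by the below-ray monomials, `ℓ ≥ e`) (OURS bookkeeping definition;
cf. Hironaka2017 Eq. (79)/(80) p.52 — not a statement of the manuscript). [folklore] -/
def MemBelow (p e : ℕ) (α β : Fin n →₀ ℕ) (W : MvPowerSeries (Fin n) K) : Prop :=
  ∀ m : Fin n →₀ ℕ, coeff m W ≠ 0 → IsBelowRay p e α β m

end Model

/-- [OURS · L W2.5 · K2.5 · MODEL B4] Conditions (i) ∧ (ii) of the pre-registered question for a standard expression
`X′` of `ε′` of depth `ℓ` on SW (`p = 2`, `e = 1`): top pair `(e₂, 0)`, and all derivative orders `|α + pβ|`,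
`|qγ_j|` of the (finite) top block `< p^ℓ = 2^ℓ` (the `ρ^ℓ`-unit-or-zero coefficients are part of the type of `X′`)
(OURS test predicate; cf. Hironaka2017 Lem. 9.5 p.50 l.11–14 — not a statement of the manuscript). [folklore] -/
def AdmissibleTop (ℓ : ℕ) {ε' : MvPowerSeries (Fin 3) 𝔽} (X : StandardExpression 2 MvPowerSeries.X 1 ℓ ε') : Prop :=
  alpha X.support X.u = Finsupp.single 2 1 ∧ beta X.support X.u = 0 ∧
    (topFrontierExp 2 X.support X.u).degree < 2 ^ ℓ ∧
    ∀ t ∈ topBlock X.support X.u, (2 • t.2.2).degree < 2 ^ ℓ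

/-- [OURS · L W2.5 · K2.5] THE QUESTION at depth `ℓ` on SW: is there `ε′` with `E − ε′ ∈ M_<` (iii) admitting a
standard expression of depth `ℓ` that satisfies (i) ∧ (ii)? (OURS test predicate; cf. Hironaka2017 Lem. 9.5 p.50
l.11–14 — not a statement of the manuscript.) [folklore] -/
def ExistsAdmissibleFiniteRay (ℓ : ℕ) : Prop :=
  ∃ ε' : MvPowerSeries (Fin 3) 𝔽, MemBelow 2 1 (Finsupp.single 2 1) 0 (toFin 𝔽 2 εW - ε') ∧
    ∃ X : StandardExpression 2 MvPowerSeries.X 1 ℓ ε', AdmissibleTop ℓ X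

/-! ## §2 On SW «strictly below the AB-ray» means: all exponents even (`x^m ∈ ρ(O)`) -/

/-- `toLex f < toLex e₂ ↔ f = 0` on `ℕ³` (lex with index `0` most significant: `e₂ = (0,0,1)` is the least non-zero
vector). [folklore] -/
theorem toLex_lt_single_two_iff (f : Fin 3 →₀ ℕ) :
    toLex f < toLex (Finsupp.single (2 : Fin 3) 1) ↔ f = 0 := by
  constructor
  · intro h
    obtain ⟨i, hi, hlt⟩ := Finsupp.Lex.lt_iff.1 h
    have hi2 : i = 2 := by
      fin_cases i
      · simp at hlt
      · simp at hlt
      · rfl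
    subst hi2
    simp only [ofLex_toLex, Finsupp.single_eq_same, Nat.lt_one_iff] at hlt
    ext j
    fin_cases j
    · simpa using hi 0 (by decide)
    · simpa using hi 1 (by decide)
    · simpa using hlt
  · rintro rfl
    refine Finsupp.Lex.lt_iff.2 ⟨2, fun j hj => ?_, by simp⟩
    have hj2 : j ≠ 2 := ne_of_lt hj
    simp [Finsupp.single_eq_of_ne hj2]

/-- **On SW, `x^m` is strictly below the AB-ray iff every exponent is even** (`x^m ∈ ρ(O) = 𝔽₂⟦y², ω₁², ω₂²⟧`):
with `e = 1` the `b`-digits vanish and `α = e₂` is the least non-zero `a`-digit vector. [folklore] -/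
theorem isBelowRay_SW_iff (m : Fin 3 →₀ ℕ) :
    IsBelowRay 2 1 (Finsupp.single 2 1) 0 m ↔ ∀ i, 2 ∣ m i := by
  have hB : digitB 2 1 m = 0 := by
    ext i
    simp [digitB, Nat.mod_one]
  unfold IsBelowRay monoKey
  rw [hB, Prod.Lex.toLex_lt_toLex]
  dsimp only
  rw [toLex_lt_single_two_iff]
  simp only [lt_self_iff_false, and_false, or_false]
  constructor
  · intro h i
    have := DFunLike.congr_fun h i
    simp only [digitA, Finsupp.mapRange_apply, Finsupp.coe_zero, Pi.zero_apply] at this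
    exact Nat.dvd_of_mod_eq_zero this
  · intro h
    ext i
    simp only [digitA, Finsupp.mapRange_apply, Finsupp.coe_zero, Pi.zero_apply]
    exact Nat.mod_eq_zero_of_dvd (h i)

/-! ## §3 Every standard expression of every `ε′ ≡ E (mod M_<)` -/

section StdExpr

variable {ℓ : ℕ} {ε' : MvPowerSeries (Fin 3) 𝔽}
  (hB : MemBelow 2 1 (Finsupp.single 2 1) 0 (toFin 𝔽 2 εW - ε'))
  (X : StandardExpression 2 MvPowerSeries.X 1 ℓ ε')

include hB in
/-- A monomial NOT below the AB-ray has the same coefficient in `ε′` as in `E` (`M_<` cannot touch it). [folklore] -/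
theorem coeff_eq_of_not_isBelowRay {m : Fin 3 →₀ ℕ} (hm : ¬ IsBelowRay 2 1 (Finsupp.single 2 1) 0 m) :
    coeff m ε' = coeff m (toFin 𝔽 2 εW) := by
  by_contra hne
  apply hm
  apply hB m
  rw [map_sub, sub_ne_zero]
  exact Ne.symm hne

include hB in
/-- The monomials of `ε′`: either a ray monomial of `E` (`(0, 2k, 3)`, coefficient `1`) or all exponents even.
[folklore] -/
theorem coeff_ne_zero_cases {m : Fin 3 →₀ ℕ} (hm : coeff m ε' ≠ 0) :
    (m 0 = 0 ∧ 2 ∣ m 1 ∧ m 2 = 3) ∨ ∀ i, 2 ∣ m i := by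
  by_cases hb : IsBelowRay 2 1 (Finsupp.single 2 1) 0 m
  · exact Or.inr ((isBelowRay_SW_iff m).1 hb)
  · left
    rw [coeff_eq_of_not_isBelowRay hB hb, coeff_E] at hm
    by_contra h
    exact hm (if_neg h)

omit hB in
/-- With `e = 1` the `b`-layer is empty: `b = 0` for every term. [folklore] -/
theorem snd_fst_eq_zero {t : ExpTriple 3} (ht : t ∈ X.support) : t.2.1 = 0 := by
  ext j
  have h := X.b_lt t ht j
  simp only [Nat.sub_self, pow_zero, Nat.lt_one_iff] at h
  rw [h, Finsupp.zero_apply]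

include hB in
/-- **Shape of the effective terms.** Every effective term `t = (a, b, c)` of a standard expression of `ε′` of depth
`ℓ ≥ 1` has `b = 0` and `a ∈ {e₂, 0}` (residue-class visibility, `Lem95Coupled.exists_coeff_ne_zero_modEq_of_mem_effSupport`:
some monomial of `ε′` has the digits of `t`; it is a ray monomial of `E` or an even one).
[cite: Hironaka2017, Eq. (76) p.49 l.5–22] -/
theorem shape_of_mem_effSupport (hℓ : 1 ≤ ℓ) {t : ExpTriple 3} (ht : t ∈ effSupport X.support X.u) :
    t.2.1 = 0 ∧ (t.1 = Finsupp.single 2 1 ∨ t.1 = 0) := by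
  have htT : t ∈ X.support := effSupport_subset _ _ ht
  have hb : t.2.1 = 0 := snd_fst_eq_zero X htT
  obtain ⟨s, hs, hs1, hs2, -, hcoeff⟩ := exists_coeff_ne_zero_modEq_of_mem_effSupport le_rfl hℓ X ht
  have hsT : s ∈ X.support := effSupport_subset _ _ hs
  have hsb : s.2.1 = 0 := snd_fst_eq_zero X hsT
  have ha : ∀ i, s.1 i < 2 := fun i => X.a_lt s hsT i
  refine ⟨hb, ?_⟩
  rw [← hs1]
  rcases coeff_ne_zero_cases hB hcoeff with ⟨h0, h1, h2⟩ | hev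
  · left
    simp only [hsb, smul_zero, add_zero, Finsupp.add_apply, Finsupp.smul_apply, smul_eq_mul, pow_one] at h0 h1 h2
    have ha0 : s.1 0 = 0 := by omega
    have ha1 : s.1 1 = 0 := by have := ha 1; omega
    have ha2 : s.1 2 = 1 := by have := ha 2; omega
    ext i
    fin_cases i
    · simpa using ha0
    · simpa using ha1
    · simpa using ha2
  · right
    ext i
    have h := hev i
    simp only [hsb, smul_zero, add_zero, Finsupp.add_apply, Finsupp.smul_apply, smul_eq_mul, pow_one] at h
    have := ha i
    simp only [Finsupp.coe_zero, Pi.zero_apply]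
    omega

include hB in
/-- **The forced top-block term.** For `ℓ ≥ 2` the ray monomial `ω₁^{2^ℓ−2} ω₂³` of `ε′` (coefficient `1`, not below
the AB-ray) is carried by an effective term `t = (e₂, 0, c)` with `c = (0, 2^{ℓ−1} − 1, 1)` exactly.
[cite: Hironaka2017, Eq. (76)/(77) p.49] -/
theorem exists_large_term (hℓ : 2 ≤ ℓ) :
    ∃ t ∈ effSupport X.support X.u, t.1 = Finsupp.single 2 1 ∧ t.2.1 = 0 ∧
      t.2.2 0 = 0 ∧ t.2.2 1 = 2 ^ (ℓ - 1) - 1 ∧ t.2.2 2 = 1 := by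
  have hpow : 2 ^ ℓ = 2 * 2 ^ (ℓ - 1) := by
    rw [← pow_succ', Nat.sub_add_cancel (by omega : 1 ≤ ℓ)]
  have hP : 2 ≤ 2 ^ (ℓ - 1) := by
    calc 2 = 2 ^ 1 := by norm_num
      _ ≤ 2 ^ (ℓ - 1) := Nat.pow_le_pow_right (by norm_num) (by omega)
  have n10 : (1 : Fin 3) ≠ 0 := by decide
  have n20 : (2 : Fin 3) ≠ 0 := by decide
  have n21 : (2 : Fin 3) ≠ 1 := by decide
  have n12 : (1 : Fin 3) ≠ 2 := by decide
  have n01 : (0 : Fin 3) ≠ 1 := by decide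
  have n02 : (0 : Fin 3) ≠ 2 := by decide
  set m : Fin 3 →₀ ℕ := Finsupp.single 1 (2 ^ ℓ - 2) + Finsupp.single 2 3 with hm
  have hm0 : m 0 = 0 := by
    simp only [m, Finsupp.add_apply, Finsupp.single_eq_of_ne n01, Finsupp.single_eq_of_ne n02, add_zero]
  have hm1 : m 1 = 2 ^ ℓ - 2 := by
    simp only [m, Finsupp.add_apply, Finsupp.single_eq_same, Finsupp.single_eq_of_ne n12, add_zero]
  have hm2 : m 2 = 3 := by
    simp only [m, Finsupp.add_apply, Finsupp.single_eq_same, Finsupp.single_eq_of_ne n21, zero_add]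
  -- the monomial is on the ray (odd `ω₂`-exponent), so its coefficient in `ε′` is that in `E`, namely `1`
  have hnot : ¬ IsBelowRay 2 1 (Finsupp.single 2 1) 0 m := by
    rw [isBelowRay_SW_iff]
    intro h
    have := h 2
    rw [hm2] at this
    omega
  have hcoeff : coeff m ε' ≠ 0 := by
    rw [coeff_eq_of_not_isBelowRay hB hnot, coeff_E, hm0, hm1, hm2, if_pos ⟨rfl, ⟨2 ^ (ℓ - 1) - 1, by omega⟩, rfl⟩]
    exact one_ne_zero
  obtain ⟨t, ht, k, hk⟩ := exists_mem_effSupport_of_coeff_ne_zero' X hcoeff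
  obtain ⟨hb, ha⟩ := shape_of_mem_effSupport hB X (by omega) ht
  rw [hb] at hk
  -- coordinate 2 forces `a = e₂`
  have hk2 := DFunLike.congr_fun hk 2
  rw [hm2] at hk2
  simp only [Finsupp.add_apply, Finsupp.smul_apply, smul_eq_mul, Finsupp.coe_zero, Pi.zero_apply, mul_zero,
    add_zero, pow_one] at hk2
  have ha2 : t.1 = Finsupp.single 2 1 := by
    rcases ha with h | h
    · exact h
    · exfalso
      rw [h, Finsupp.coe_zero, Pi.zero_apply, zero_add] at hk2
      obtain ⟨z, hz⟩ : 2 ∣ 2 ^ ℓ * k 2 := Dvd.dvd.mul_right (dvd_pow_self 2 (by omega)) _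
      rw [hz] at hk2
      omega
  rw [ha2] at hk
  have hk0 : 0 = 2 * t.2.2 0 + 2 ^ ℓ * k 0 := by
    have h := DFunLike.congr_fun hk 0
    rw [hm0] at h
    simpa only [Finsupp.add_apply, Finsupp.smul_apply, smul_eq_mul, Finsupp.coe_zero, Pi.zero_apply,
      mul_zero, add_zero, Finsupp.single_eq_of_ne n02, zero_add, pow_one] using h
  have hk1 : 2 ^ ℓ - 2 = 2 * t.2.2 1 + 2 ^ ℓ * k 1 := by
    have h := DFunLike.congr_fun hk 1
    rw [hm1] at h
    simpa only [Finsupp.add_apply, Finsupp.smul_apply, smul_eq_mul, Finsupp.coe_zero, Pi.zero_apply,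
      mul_zero, add_zero, Finsupp.single_eq_of_ne n12, zero_add, pow_one] using h
  have hk2' : 3 = 1 + 2 * t.2.2 2 + 2 ^ ℓ * k 2 := by
    have h := DFunLike.congr_fun hk 2
    rw [hm2] at h
    simpa only [Finsupp.add_apply, Finsupp.smul_apply, smul_eq_mul, Finsupp.coe_zero, Pi.zero_apply,
      mul_zero, add_zero, Finsupp.single_eq_same, pow_one] using h
  refine ⟨t, ht, ha2, hb, ?_, ?_, ?_⟩
  · have : 2 * t.2.2 0 ≤ 2 * t.2.2 0 + 2 ^ ℓ * k 0 := Nat.le_add_right _ _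
    omega
  · have hk1' : k 1 = 0 := by
      by_contra hne
      have : 2 ^ ℓ ≤ 2 ^ ℓ * k 1 := Nat.le_mul_of_pos_right _ (Nat.pos_of_ne_zero hne)
      omega
    rw [hk1', mul_zero, add_zero] at hk1
    omega
  · have hk2z : k 2 = 0 := by
      by_contra hne
      have : 2 ^ ℓ ≤ 2 ^ ℓ * k 2 := Nat.le_mul_of_pos_right _ (Nat.pos_of_ne_zero hne)
      omega
    rw [hk2z, mul_zero, add_zero] at hk2'
    omega

/-- `toLex 0 ≤ toLex f` on `ℕ³`. [folklore] -/
private theorem toLex_zero_le (f : Fin 3 →₀ ℕ) : toLex (0 : Fin 3 →₀ ℕ) ≤ toLex f :=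
  Finsupp.toLex_monotone (by intro i; simp)

include hB in
/-- Every effective term has pair key `≤` that of the forced term: `(0, 0) ≤ (e₂, 0)` and `(e₂, 0) ≤ (e₂, 0)`.
[folklore] -/
private theorem pairKey_le_of_large (hℓ : 2 ≤ ℓ) {t : ExpTriple 3}
    (ht1 : t.1 = Finsupp.single 2 1) (ht2 : t.2.1 = 0) :
    ∀ s ∈ effSupport X.support X.u, pairKey s ≤ pairKey t := by
  intro s hs
  obtain ⟨hsb, hsa⟩ := shape_of_mem_effSupport hB X (by omega) hs
  rcases hsa with h | h
  · rw [pairKey_eq_of_eq (h.trans ht1.symm) (hsb.trans ht2.symm)]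
  · unfold pairKey
    rw [h, hsb, ht1, ht2, Prod.Lex.toLex_le_toLex]
    left
    show toLex (0 : Fin 3 →₀ ℕ) < toLex (Finsupp.single (2 : Fin 3) 1)
    exact lt_of_le_of_ne (toLex_zero_le _) (by
      intro heq
      have := DFunLike.congr_fun (toLex_inj.1 heq) 2
      simp at this)

include hB in
/-- **(i) is automatic: `α = e₂`** for every standard expression of `ε′` (depth `ℓ ≥ 2`).
[cite: Hironaka2017, Eq. (76) p.49 l.5] -/
theorem alpha_eq (hℓ : 2 ≤ ℓ) : alpha X.support X.u = Finsupp.single 2 1 := by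
  obtain ⟨t, ht, ht1, ht2, -⟩ := exists_large_term hB X hℓ
  rw [alpha_eq_of_isGreatest _ _ ht (pairKey_le_of_large hB X hℓ ht1 ht2)]
  exact ht1

include hB in
/-- **(i) is automatic: `β = 0`** for every standard expression of `ε′` (depth `ℓ ≥ 2`).
[cite: Hironaka2017, Eq. (76) p.49 l.5] -/
theorem beta_eq (hℓ : 2 ≤ ℓ) : beta X.support X.u = 0 := by
  obtain ⟨t, ht, ht1, ht2, -⟩ := exists_large_term hB X hℓ
  rw [beta_eq_of_isGreatest _ _ ht (pairKey_le_of_large hB X hℓ ht1 ht2)]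
  exact ht2

include hB in
/-- **THE OBSTRUCTION (numbers for res-adj-2).** For `ℓ ≥ 2`, every standard expression of every `ε′ ≡ E (mod M_<)`
has a TOP-BLOCK term whose derivative order `|qγ| = |2 • c|` is `≥ 2^ℓ = p^ℓ` — namely the forced term
`(e₂, 0, (0, 2^{ℓ−1} − 1, 1))` with `|2 • c| = 2^ℓ` exactly. [cite: Hironaka2017, Lem. 9.5 p.50 l.11–14] -/
theorem exists_topBlock_degree_ge (hℓ : 2 ≤ ℓ) :
    ∃ t ∈ topBlock X.support X.u, (2 • t.2.2).degree = 2 ^ ℓ := by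
  obtain ⟨t, ht, ht1, ht2, hc0, hc1, hc2⟩ := exists_large_term hB X hℓ
  refine ⟨t, (mem_topBlock _ _).2 ⟨ht, ?_, ?_⟩, ?_⟩
  · rw [alpha_eq hB X hℓ, ht1]
  · rw [beta_eq hB X hℓ, ht2]
  · have hpow : 2 ^ ℓ = 2 * 2 ^ (ℓ - 1) := by
      rw [← pow_succ', Nat.sub_add_cancel (by omega : 1 ≤ ℓ)]
    have hP : 1 ≤ 2 ^ (ℓ - 1) := Nat.one_le_two_pow
    rw [Finsupp.degree_eq_sum, Fin.sum_univ_three]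
    simp only [Finsupp.smul_apply, smul_eq_mul, hc0, hc1, hc2]
    omega

end StdExpr

/-! ## §4 T1 / T2: the pre-registered question answered at every depth `ℓ ≥ 2`, in particular `ℓ = 3, 4` -/

/-- **K2.5 on SW, every depth `ℓ ≥ 2`: NO admissible finite ray.** There is no `ε′` with `E − ε′ ∈ M_<` admitting
a standard expression of depth `ℓ` whose top block has all derivative orders `< 2^ℓ` (conditions (i)–(iii) of the
PREREG). [cite: Hironaka2017, Lem. 9.5 p.50 l.11–14] -/
theorem not_existsAdmissibleFiniteRay {ℓ : ℕ} (hℓ : 2 ≤ ℓ) : ¬ ExistsAdmissibleFiniteRay ℓ := by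
  rintro ⟨ε', hB, X, -, -, -, htop⟩
  obtain ⟨t, ht, hdeg⟩ := exists_topBlock_degree_ge hB X hℓ
  have := htop t ht
  omega

/-- **T1 (`ℓ = 3`): NO** — the forced top-block term has `|qγ| = 8 = p^ℓ`. [cite: Hironaka2017, Lem. 9.5 p.50 l.11–14] -/
theorem T1_depth_three : ¬ ExistsAdmissibleFiniteRay 3 := not_existsAdmissibleFiniteRay (by norm_num)

/-- **T2 (`ℓ = 4`): NO** — the forced top-block term has `|qγ| = 16 = p^ℓ`. [cite: Hironaka2017, Lem. 9.5 p.50 l.11–14] -/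
theorem T2_depth_four : ¬ ExistsAdmissibleFiniteRay 4 := not_existsAdmissibleFiniteRay (by norm_num)

/-- The numbers behind T1: at `ℓ = 3` every standard expression of every admissible `ε′` has a top-block term with
`|2 • c| = 8`. [cite: Hironaka2017, Lem. 9.5 p.50 l.11–14] -/
theorem T1_numbers {ε' : MvPowerSeries (Fin 3) 𝔽}
    (hB : MemBelow 2 1 (Finsupp.single 2 1) 0 (toFin 𝔽 2 εW - ε'))
    (X : StandardExpression 2 MvPowerSeries.X 1 3 ε') :
    alpha X.support X.u = Finsupp.single 2 1 ∧ beta X.support X.u = 0 ∧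
      ∃ t ∈ topBlock X.support X.u, (2 • t.2.2).degree = 8 :=
  ⟨alpha_eq hB X (by norm_num), beta_eq hB X (by norm_num),
    by simpa using exists_topBlock_degree_ge hB X (show 2 ≤ 3 by norm_num)⟩

end Summit.ResolutionOfSingularities.ResolutionOfSingularities.Theorems.CampaignW25.SW

end
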